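import Literature.RingTheory.MvPolynomial.FormalCubeIntegral
import Mathlib.RingTheory.MvPolynomial.Tower
import Mathlib.Algebra.Module.Rat
import HarnessLib

/-!
# The formal cube integral of operator-valued polynomials read through a linear functional

Topic `Literature/RingTheory/MvPolynomial`; a complement to `FormalCubeIntegral.lean` (`cubeIntegral ι A :
MvPolynomial ι A →ₗ[A] A`, `∫_{[0,1]^ι} Σ a_d t^d dt = Σ a_d ∏ (dᵢ+1)⁻¹`).  In the operator form of the
Battle–Brydges–Federbush expansion (`Probability/LatticeModels/BattleFederbushExponential.lean`) the
polynomials have coefficients in a commutative algebra `A` of OPERATORS, and estimates are obtained by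
reading them through an `R`-linear functional `θ : A →ₗ[R] R` (e.g. "apply to a vector and take a
coefficient") down to scalar polynomials, whose formal integral is a genuine integral.  This file provides
the coefficientwise map and its three compatibilities:

* `coeffMap θ P` — apply `θ` to every coefficient; `coeff_coeffMap`, `coeffMap_add`, `coeffMap_monomial`,
  `coeffMap_monomial_one_mul` (a weight monomial `t^d` passes through);
* `cubeIntegral_coeffMap` — **`∫ (θ ∘ P) dt = θ (∫ P dt)`**;
* `eval_coeffMap` — **`(θ ∘ P)(t) = θ (P(t))`** at every scalar point `t : ι → R`, `P(t)` the evaluation of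
  `P` at `algebraMap R A ∘ t`.

Everything is proved; no named fact. [folklore]
-/

noncomputable section

open MvPolynomial Finsupp

namespace Literature.RingTheory.MvPolynomial

variable {ι : Type*} {R : Type*} [CommRing R] {A : Type*} [CommRing A] [Algebra R A]

/-- **Apply a linear functional to every coefficient** of a polynomial with coefficients in an algebra
`A`: `Σ_d a_d t^d ↦ Σ_d θ(a_d) t^d`. [folklore] -/
def coeffMap (θ : A →ₗ[R] R) (P : MvPolynomial ι A) : MvPolynomial ι R :=
  ∑ d ∈ P.support, monomial d (θ (coeff d P))

/-- The coefficients of `coeffMap θ P`. [folklore] -/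
@[simp] theorem coeff_coeffMap (θ : A →ₗ[R] R) (P : MvPolynomial ι A) (d : ι →₀ ℕ) :
    coeff d (coeffMap θ P) = θ (coeff d P) := by
  classical
  rw [coeffMap, coeff_sum]
  simp only [coeff_monomial]
  rw [Finset.sum_ite_eq']
  split_ifs with h
  · rfl
  · rw [MvPolynomial.notMem_support_iff.1 h, map_zero]

/-- `coeffMap` is additive. [folklore] -/
theorem coeffMap_add (θ : A →ₗ[R] R) (P Q : MvPolynomial ι A) :
    coeffMap θ (P + Q) = coeffMap θ P + coeffMap θ Q := by
  ext d
  simp only [coeff_coeffMap, coeff_add, map_add]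

/-- `coeffMap` on a monomial. [folklore] -/
@[simp] theorem coeffMap_monomial (θ : A →ₗ[R] R) (d : ι →₀ ℕ) (a : A) :
    coeffMap θ (monomial d a) = monomial d (θ a) := by
  classical
  ext d'
  simp only [coeff_coeffMap, coeff_monomial]
  split_ifs
  · rfl
  · exact θ.map_zero

/-- **A weight monomial passes through**: `coeffMap θ (t^d · P) = t^d · coeffMap θ P`. [folklore] -/
theorem coeffMap_monomial_one_mul (θ : A →ₗ[R] R) (d : ι →₀ ℕ) (P : MvPolynomial ι A) :
    coeffMap θ (monomial d 1 * P) = monomial d 1 * coeffMap θ P := by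
  classical
  induction P using MvPolynomial.induction_on' with
  | monomial e a => rw [monomial_mul, one_mul, coeffMap_monomial, coeffMap_monomial, monomial_mul, one_mul]
  | add p q hp hq => rw [mul_add, coeffMap_add, hp, hq, coeffMap_add, mul_add]

variable [Fintype ι]

/-- **The formal cube integral commutes with the coefficient functional**: `∫ (θ ∘ P) dt = θ (∫ P dt)`.
[folklore] -/
theorem cubeIntegral_coeffMap [Algebra ℚ R] [Algebra ℚ A] (θ : A →ₗ[R] R) (P : MvPolynomial ι A) :
    cubeIntegral ι R (coeffMap θ P) = θ (cubeIntegral ι A P) := by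
  induction P using MvPolynomial.induction_on' with
  | monomial d a =>
    rw [coeffMap_monomial, cubeIntegral_monomial, cubeIntegral_monomial, Algebra.algebraMap_eq_smul_one,
      Algebra.algebraMap_eq_smul_one, mul_smul_one, mul_smul_one, map_rat_smul θ]
  | add p q hp hq => rw [coeffMap_add, map_add, map_add, map_add, hp, hq]

omit [Fintype ι] in
/-- **Evaluation commutes with the coefficient functional**: at a scalar point `t : ι → R`,
`(coeffMap θ P)(t) = θ (P (algebraMap ∘ t))`. [folklore] -/
theorem eval_coeffMap (θ : A →ₗ[R] R) (P : MvPolynomial ι A) (t : ι → R) :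
    eval t (coeffMap θ P) = θ (aeval (fun i => algebraMap R A (t i)) P) := by
  classical
  induction P using MvPolynomial.induction_on' with
  | monomial d a =>
    rw [coeffMap_monomial, eval_monomial, aeval_monomial]
    have hprod : (d.prod fun i k => algebraMap R A (t i) ^ k) = algebraMap R A (d.prod fun i k => t i ^ k) := by
      rw [Finsupp.prod, Finsupp.prod, map_prod]
      simp only [map_pow]
    rw [hprod, Algebra.algebraMap_self, RingHom.id_apply, ← Algebra.commutes, ← Algebra.smul_def, map_smul,
      smul_eq_mul, mul_comm]
  | add p q hp hq => rw [coeffMap_add, map_add, map_add, map_add, hp, hq]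

end Literature.RingTheory.MvPolynomial
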